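import Literature.NumberTheory.EllipticCurves.HeegnerPointsKolyvaginPrimaryCongruenceProofs
import Literature.NumberTheory.EllipticCurves.HeegnerPointsKolyvaginCebotarevProofs
import HarnessLib

/-!
# Route `PrintCFram`, crux C2 `BottomClassIndexLawFiveLe` (stmt-BirchSwinnertonDyer-20372), road II
# (`borel_heegner_squeeze` S2 `stub_kolyvaginUpper_borelCM`): **McCallum's congruences
# `p^M ∣ ℓ + 1`, `p^M ∣ a_ℓ` at a prime whose Frobenius acts on `E[p^M]` as MINUS a complex
# conjugation** (Kolyvagin primes of the second Frobenius type)
# (cell `bsd-print-cfram`, width seat `bsd-line-cfram-p1-w5` g12; helper `--supports` 20372;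
# 0 facts, 0 defs, 0 sorry)

HONEST FRAMING. Nothing about BSD is proved here, and nothing of the stub itself. Companion of
`…BorelTypeTwoCebotarev` (the Čebotarev step for `ρ` with `ρ^τρ ∈ Γ_{K(E[p^M])}`) and
`…BorelTypeTwoVisibility` (the blind line is seen at such primes). Gross's (3.2) `Frob(ℓ) = Frob(∞)`
on `ℚ(E_{p^M})` implies McCallum's §4 congruences `p^M ∣ ℓ + 1`, `p^M ∣ a_ℓ` (tree,
`…PrimaryCongruenceProofs`); this file proves the SAME congruences for a prime `ℓ` whose arithmetic
Frobenius `h` acts on `E(ℚ̄)[p^M]` as `P ↦ −(c₀ P)`, `c₀` a complex conjugation — the second Frobenius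
type, which on the Borel CM class is NOT of type (3.2):
* `absGaloisRestrict_smul_eq_neg_of_smul_eq_neg`, `mul_absGaloisRestrict_smul_eq_neg` — transport:
  `c₀ · res(ρm)` acts on `E(ℚ̄)[n]` as `−c₀` when `ρ ∈ Γ_K` acts on `E(K̄)[n]` as `−1` and `m` fixes it;
* `smul_eq_inv_of_smul_torsion_pow_eq_neg` — such an `h` inverts `μ_{p^M}` (Weil pairing:
  `h·e(S,T) = e(−c₀S, −c₀T) = e(c₀S, c₀T) = c₀·e(S,T) = e(S,T)⁻¹`; the tree's proof plus
  `e(−S, −T) = e(S, T)`);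
* **`pow_dvd_add_one_of_smul_eq_neg`** (`h ζ = ζ⁻¹ = ζ^ℓ` on a primitive `p^M`-th root of unity) and
  **`pow_dvd_frobeniusTraceAt_of_smul_eq_neg`** (`a_ℓ = tr(h | T_p E)`, `det ≡ −1`, `h² = 1` on
  `E[p^M]`, Cayley–Hamilton) — the proofs of `pow_dvd_add_one_of_frobEqFrobInfty` /
  `pow_dvd_frobeniusTraceAt_of_frobEqFrobInfty` with `c₀` replaced by `−c₀`.
THEOREMS ONLY; no definition, no named fact, no `sorry`. BSD is not proved by any of this; no summit
statement is proved by this seat. References: [McCallumLMS1991] §4 (Kolyvagin primes of level `M`);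
[GrossLMS1991] §3 (3.3); [SilvermanAEC2009] Prop. III.8.1, III.§7, C.21 Remark 21.3.
-/

set_option autoImplicit false
-- `…BirchSwinnertonDyer.BirchSwinnertonDyer.Theorems…` is the problem's mandated namespace (D-0017).
set_option linter.dupNamespace false

noncomputable section

open scoped Classical Pointwise

namespace Summit.BirchSwinnertonDyer.BirchSwinnertonDyer.Theorems.PrintCFram.BorelTypeTwo

open WeierstrassCurve NumberField IsDedekindDomain Field Literature.NumberTheory.EllipticCurves
  Literature.NumberTheory.GaloisRepresentations

universe u v

/-! ## §3 McCallum's congruences `p^M ∣ ℓ + 1`, `p^M ∣ a_ℓ` at a prime of the second Frobenius type -/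

section Congruences

variable (W : WeierstrassCurve ℚ) {K : Type u} [Field K] [NumberField K]

/-- **Transport to `E(ℚ̄)[n]`:** an element of `Γ_K` acting on `E(K̄)[n]` as `−1` acts on `E(ℚ̄)[n]`
as `−1` through `res : Γ_K → Γ_ℚ` (`RatClosure.torsionEquiv_smul`). [folklore] -/
theorem absGaloisRestrict_smul_eq_neg_of_smul_eq_neg {n : ℤ} {g : absoluteGaloisGroup K}
    (hg : ∀ P : geomTorsion (W.baseChange K) n, g • P = -P) (P : geomTorsion W n) :
    absGaloisRestrict ℚ K g • P = -P := by
  apply (RatClosure.torsionEquiv (K := K) W n).injective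
  rw [RatClosure.torsionEquiv_smul, hg, map_neg]

/-- The Frobenius `h = c₀ · res(ρm)` of §2 acts on `E(ℚ̄)[n]` as `P ↦ −(c₀ P)` when `ρ` acts on
`E(K̄)[n]` as `−1` and `m ∈ Γ_{K(E[n])}`. [folklore] -/
theorem mul_absGaloisRestrict_smul_eq_neg {n : ℤ} (c₀ : absoluteGaloisGroup ℚ)
    {ρ m : absoluteGaloisGroup K} (hρ : ∀ P : geomTorsion (W.baseChange K) n, ρ • P = -P)
    (hm : m ∈ torsionFixing (W.baseChange K) n) (P : geomTorsion W n) :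
    (c₀ * absGaloisRestrict ℚ K (ρ * m)) • P = -(c₀ • P) := by
  rw [mul_smul, absGaloisRestrict_smul_eq_neg_of_smul_eq_neg W (fun Q ↦ by
    rw [mul_smul, smul_eq_of_mem_torsionFixing _ n hm, hρ]), smul_neg]

/-- **An automorphism acting on `E(ℚ̄)[p^M]` as MINUS a complex conjugation still inverts
`μ_{p^M}`**: with the Weil pairing `e = e_{p^M}` (tree `exists_weilPairing_holds`),
`h · e(S, T) = e(hS, hT) = e(−c₀S, −c₀T) = e(c₀S, c₀T) = c₀ · e(S, T) = e(S, T)⁻¹`, and every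
`ζ ∈ μ_{p^M}` is a value of `e` (the proof of the tree's `smul_eq_inv_of_smul_torsion_pow_eq`, with
the one extra line `e(−S, −T) = e(S, T)`). [cite: McCallumLMS1991, §4 (Kolyvagin primes of level M)]
[cite: SilvermanAEC2009, Prop. III.8.1] -/
theorem smul_eq_inv_of_smul_torsion_pow_eq_neg [W.IsElliptic] {p : ℕ} (hp : p.Prime) {M : ℕ}
    (hM : 1 ≤ M) {q : ℕ} (hq : q = p ^ M) {h c₀ : absoluteGaloisGroup ℚ}
    (hc₀ : IsComplexConjugation (Rat.castHom ℝ) c₀)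
    (hhP : ∀ P : geomTorsion W (q : ℤ), h • P = -(c₀ • P)) {ζ : AlgebraicClosure ℚ}
    (hζ : ζ ^ q = 1) : h • ζ = ζ⁻¹ := by
  haveI : Fact p.Prime := ⟨hp⟩
  subst hq
  obtain ⟨n, rfl⟩ : ∃ n, M = n + 1 := ⟨M - 1, by omega⟩
  have hq0 : p ^ (n + 1) ≠ 0 := pow_ne_zero _ hp.ne_zero
  have hq2 : 2 ≤ p ^ (n + 1) :=
    le_trans hp.two_le (by
      calc p = p ^ 1 := (pow_one p).symm
        _ ≤ p ^ (n + 1) := Nat.pow_le_pow_right hp.pos (by omega))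
  obtain ⟨e, hpow, hadd₁, hadd₂, -, hnd, hgal⟩ :=
    W.exists_weilPairing_holds (p ^ (n + 1)) hq2 (by exact_mod_cast hq0)
  have hne : ∀ S T, e S T ≠ 0 := fun S T h0 ↦ by
    have := hpow S T
    rw [h0, zero_pow hq0] at this
    exact zero_ne_one this
  have hzero_right : ∀ S, e S 0 = 1 := fun S ↦ by
    have h1 := hadd₂ S 0 0
    rw [add_zero] at h1
    exact (mul_eq_left₀ (hne S 0)).mp h1.symm
  have hzero_left : ∀ T, e 0 T = 1 := fun T ↦ by
    have h1 := hadd₁ 0 0 T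
    rw [add_zero] at h1
    exact (mul_eq_left₀ (hne 0 T)).mp h1.symm
  -- `e(−S, −T) = e(S, T)`
  have hneg : ∀ S T, e (-S) (-T) = e S T := fun S T ↦ by
    have h1 : e (-S) (-T) * e S (-T) = 1 := by rw [← hadd₁, neg_add_cancel, hzero_left]
    have h2 : e S (-T) * e S T = 1 := by rw [← hadd₂, neg_add_cancel, hzero_right]
    have h3 : e S (-T) = (e S T)⁻¹ := eq_inv_of_mul_eq_one_left h2
    rw [h3] at h1
    exact (eq_inv_of_mul_eq_one_left h1).trans (inv_inv _)
  -- `h` inverts every value of `e`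
  have hval : ∀ S T, h • e S T = (e S T)⁻¹ := fun S T ↦ by
    rw [hgal, hhP, hhP, hneg, ← hgal, RatClosure.smul_eq_inv_of_pow_eq_one hc₀ hq0 (hpow S T)]
  -- `e S (m • T) = (e S T)^m`
  have hnsmul_right : ∀ (m : ℕ) S T, e S (m • T) = e S T ^ m := fun m S T ↦ by
    induction m with
    | zero => rw [zero_nsmul, pow_zero, hzero_right]
    | succ m ih => rw [succ_nsmul, hadd₂, ih, pow_succ]
  -- some `S₀` with `p^n S₀ ≠ 0`
  have hqn0 : p ^ n ≠ 0 := pow_ne_zero n hp.ne_zero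
  haveI : Finite (geomTorsion W ((p ^ (n + 1) : ℕ) : ℤ)) :=
    finite_torsionPoints_holds W (AlgebraicClosure ℚ) (by exact_mod_cast hq0)
  haveI : Finite (geomTorsion W ((p ^ n : ℕ) : ℤ)) :=
    finite_torsionPoints_holds W (AlgebraicClosure ℚ) (by exact_mod_cast hqn0)
  have hc1 : Nat.card (geomTorsion W ((p ^ (n + 1) : ℕ) : ℤ)) = (p ^ (n + 1)) ^ 2 :=
    card_torsionPoints_eq_sq_holds W (AlgebraicClosure ℚ) (by exact_mod_cast hq0)
  have hc2 : Nat.card (geomTorsion W ((p ^ n : ℕ) : ℤ)) = (p ^ n) ^ 2 :=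
    card_torsionPoints_eq_sq_holds W (AlgebraicClosure ℚ) (by exact_mod_cast hqn0)
  obtain ⟨S₀, hS₀⟩ : ∃ S₀ : geomTorsion W ((p ^ (n + 1) : ℕ) : ℤ), p ^ n • S₀ ≠ 0 := by
    by_contra hall
    push Not at hall
    have hle : Nat.card (geomTorsion W ((p ^ (n + 1) : ℕ) : ℤ)) ≤
        Nat.card (geomTorsion W ((p ^ n : ℕ) : ℤ)) :=
      Nat.card_le_card_of_injective
        (fun S ↦ (⟨S.1, (mem_geomTorsion_iff W _ _).mpr (by
          have h1 := congrArg Subtype.val (hall S)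
          rw [AddSubgroupClass.coe_nsmul, ZeroMemClass.coe_zero, ← natCast_zsmul,
            Nat.cast_pow] at h1
          rw [Nat.cast_pow]
          exact h1)⟩ : geomTorsion W ((p ^ n : ℕ) : ℤ)))
        (fun S S' hS ↦ Subtype.ext (by simpa using congrArg Subtype.val hS))
    rw [hc1, hc2] at hle
    have hlt : p ^ n < p ^ (n + 1) := Nat.pow_lt_pow_right hp.one_lt (by omega)
    have := Nat.pow_lt_pow_left hlt two_ne_zero
    omega
  -- some `T₀` with `e T₀ S₀` a primitive `p^{n+1}`-th root of unity
  obtain ⟨T₀, hT₀⟩ : ∃ T₀, e T₀ S₀ ^ p ^ n ≠ 1 := by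
    by_contra hall
    push Not at hall
    exact hS₀ (hnd _ fun S ↦ by rw [hnsmul_right, hall])
  have hord : orderOf (e T₀ S₀) = p ^ (n + 1) := orderOf_eq_prime_pow hT₀ (hpow T₀ S₀)
  have hprim : IsPrimitiveRoot (e T₀ S₀) (p ^ (n + 1)) := hord ▸ IsPrimitiveRoot.orderOf _
  obtain ⟨k, -, hk⟩ := hprim.eq_pow_of_pow_eq_one hζ
  rw [← hk, smul_pow', hval, inv_pow]

/-- **`p^M ∣ ℓ + 1` at a prime of the second Frobenius type** (McCallum 1991, §4, first congruence):
if an arithmetic Frobenius `h ∈ Γ_ℚ` at a prime above `ℓ ≠ p` acts on `E(ℚ̄)[p^M]` as `−c₀` for a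
complex conjugation `c₀` (`M ≥ 1`), then `p^M ∣ ℓ + 1` — on a primitive `p^M`-th root of unity
`h ζ = ζ⁻¹` (`smul_eq_inv_of_smul_torsion_pow_eq_neg`) and `h ζ = ζ^ℓ`. The proof of the tree's
`pow_dvd_add_one_of_frobEqFrobInfty` with the sign. [cite: McCallumLMS1991, §4]
[cite: GrossLMS1991, §3 (3.3)] -/
theorem pow_dvd_add_one_of_smul_eq_neg [W.IsElliptic] {p : ℕ} (hp : p.Prime) {M : ℕ}
    (hM : 1 ≤ M) {ℓ : ℕ} (hℓ : ℓ.Prime) (hℓp : ℓ ≠ p) {v : HeightOneSpectrum (𝓞 ℚ)}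
    {𝔓₀ : Ideal (absIntegers (𝓞 ℚ) ℚ)} {h c₀ : absoluteGaloisGroup ℚ}
    (hℓv : (ℓ : 𝓞 ℚ) ∈ v.asIdeal) (h𝔓₀ : 𝔓₀ ∈ v.primesAbove) (hh : IsArithFrobAt (𝓞 ℚ) h 𝔓₀)
    (hc₀ : IsComplexConjugation (Rat.castHom ℝ) c₀)
    (hE : ∀ P : geomTorsion W ((p ^ M : ℕ) : ℤ), h • P = -(c₀ • P)) :
    p ^ M ∣ ℓ + 1 := by
  haveI : Fact p.Prime := ⟨hp⟩
  have hq0 : ((p ^ M : ℕ) : AlgebraicClosure ℚ) ≠ 0 := by exact_mod_cast pow_ne_zero M hp.ne_zero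
  haveI : NeZero ((p ^ M : ℕ) : AlgebraicClosure ℚ) := ⟨hq0⟩
  obtain ⟨ζ, hζ⟩ := IsAlgClosed.exists_root (Polynomial.cyclotomic (p ^ M) (AlgebraicClosure ℚ))
    (Polynomial.degree_cyclotomic_pos (p ^ M) _ (pos_of_ne_zero (pow_ne_zero M hp.ne_zero))).ne'
  have hprim : IsPrimitiveRoot ζ (p ^ M) := Polynomial.isRoot_cyclotomic_iff.mp hζ
  have h1 : h • ζ = ζ⁻¹ :=
    smul_eq_inv_of_smul_torsion_pow_eq_neg W hp hM rfl hc₀ hE hprim.pow_eq_one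
  have hpv : (p : 𝓞 ℚ) ∉ v.asIdeal := not_natCast_mem_of_prime_ne hℓ hp hℓp v hℓv
  have h2 : h • ζ = ζ ^ v.residueCard :=
    smul_eq_pow_residueCard_of_isArithFrobAt (ℓ := p) hpv h𝔓₀ hh (n := M) hprim.pow_eq_one
  rw [residueCard_eq_of_natCast_mem_rat hℓ hℓv, h1] at h2
  have hζ0 : ζ ≠ 0 := hprim.ne_zero (pow_ne_zero M hp.ne_zero)
  have hζ1 : ζ ^ (ℓ + 1) = 1 := by
    rw [pow_succ, ← h2, inv_mul_cancel₀ hζ0]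
  exact (hprim.pow_eq_one_iff_dvd (ℓ + 1)).mp hζ1

/-- **`p^M ∣ a_ℓ` at a prime of the second Frobenius type** (McCallum 1991, §4, second congruence),
at a place `v ∋ ℓ` of good reduction for `E = W/ℚ`: an arithmetic Frobenius `h` above `ℓ ≠ p`
acting on `E(ℚ̄)[p^M]` as `−c₀` (`M ≥ 1`) has `a_ℓ = tr(h | T_p E)` (tree
`trace_galoisRepTate_frobenius_of_hasGoodReductionAt_holds`), `det(h | T_p E) ≡ −1 (mod p^M)` (it
inverts `μ_{p^M}`) and `h² = c₀² = 1` on `E[p^M]`, so `tr ≡ 0` (`toZModPow_trace_galoisRepTate_eq_zero`).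
The proof of the tree's `pow_dvd_frobeniusTraceAt_of_frobEqFrobInfty` with the sign.
[cite: McCallumLMS1991, §4] [cite: SilvermanAEC2009, C.21 Remark 21.3] -/
theorem pow_dvd_frobeniusTraceAt_of_smul_eq_neg [W.IsElliptic] {p : ℕ} (hp : p.Prime)
    {M : ℕ} (hM : 1 ≤ M) {ℓ : ℕ} (hℓ : ℓ.Prime) (hℓp : ℓ ≠ p) {v : HeightOneSpectrum (𝓞 ℚ)}
    {𝔓₀ : Ideal (absIntegers (𝓞 ℚ) ℚ)} {h c₀ : absoluteGaloisGroup ℚ}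
    (hℓv : (ℓ : 𝓞 ℚ) ∈ v.asIdeal) (h𝔓₀ : 𝔓₀ ∈ v.primesAbove) (hh : IsArithFrobAt (𝓞 ℚ) h 𝔓₀)
    (hc₀ : IsComplexConjugation (Rat.castHom ℝ) c₀)
    (hE : ∀ P : geomTorsion W ((p ^ M : ℕ) : ℤ), h • P = -(c₀ • P))
    (hgood : W.HasGoodReductionAt v) :
    ((p : ℤ) ^ M) ∣ W.frobeniusTraceAt v := by
  haveI : Fact p.Prime := ⟨hp⟩
  obtain ⟨n, rfl⟩ : ∃ n, M = n + 1 := ⟨M - 1, by omega⟩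
  have hpv : (p : 𝓞 ℚ) ∉ v.asIdeal := not_natCast_mem_of_prime_ne hℓ hp hℓp v hℓv
  have hpQ : (p : ℚ) ≠ 0 := by exact_mod_cast hp.ne_zero
  -- `tr(h | T_p E) = a_ℓ`
  have htr := W.trace_galoisRepTate_frobenius_of_hasGoodReductionAt_holds p v hpv hgood h𝔓₀ hh
  -- `det(h | T_p E) ≡ -1`: `h` inverts `μ_{p^{n+1}}`
  have hinv : ∀ t : AlgebraicClosure ℚ, t ^ p ^ (n + 1) = 1 → h • t = t ^ (p ^ (n + 1) - 1) := by
    intro t ht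
    rw [smul_eq_inv_of_smul_torsion_pow_eq_neg W hp hM rfl hc₀ hE ht]
    have ht0 : t ≠ 0 := fun h0 ↦ by
      rw [h0, zero_pow (pow_ne_zero _ hp.ne_zero)] at ht; exact zero_ne_one ht
    rw [eq_comm, ← mul_left_inj' ht0, inv_mul_cancel₀ ht0, ← pow_succ,
      Nat.sub_add_cancel (Nat.one_le_pow _ _ hp.pos), ht]
  have hdet := toZModPow_det_galoisRepTate_eq W p hpQ n (W.exists_weilPairing_holds _) h
    (p ^ (n + 1) - 1) hinv
  have hcast : ((p ^ (n + 1) - 1 : ℕ) : ZMod (p ^ (n + 1))) = -1 := by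
    rw [Nat.cast_sub (Nat.one_le_pow _ _ hp.pos), ZMod.natCast_self, Nat.cast_one, zero_sub]
  rw [hcast] at hdet
  -- `h² = 1` on `E[p^{n+1}]`
  have hsq : ∀ P : W.geomPoints, P ∈ geomTorsion W ((p ^ (n + 1) : ℕ) : ℤ) → h • h • P = P := by
    intro P hP
    have h2 : h • h • (⟨P, hP⟩ : geomTorsion W ((p ^ (n + 1) : ℕ) : ℤ)) = ⟨P, hP⟩ := by
      rw [hE, hE, smul_neg, neg_neg, ← mul_smul, ← pow_two, hc₀.sq_eq_one, one_smul]
    simpa only [AddSubgroup.torsionBy.coe_smul] using congrArg Subtype.val h2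
  have h0 := toZModPow_trace_galoisRepTate_eq_zero W p hpQ n h hsq hdet
  rw [htr, map_intCast, ZMod.intCast_zmod_eq_zero_iff_dvd] at h0
  exact_mod_cast h0

end Congruences

end Summit.BirchSwinnertonDyer.BirchSwinnertonDyer.Theorems.PrintCFram.BorelTypeTwo

end
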